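import Summits.Ventures.CertifiedManyBodySolver.Observables.SpinBox3Words
import HarnessLib

/-!
# The shifted DIAMOND kernel: the op-08 truncated staggered sum `S_pi_trunc2` plus a total-mass tap is a
# nonnegative cosine polynomial, so its certified ceiling IS a Néel-weight ceiling

HONEST FRAMING: first certified bounds on pairing observables; not a superconductivity verdict; every number certified
(two lineages + referee) or labelled float.  Cell hubbard-obs (D-0042 crew 1), seat hubbard-obs-p3 (CONTROLS), gen 2 —
CORRECTION of the seat's own 22:12Z line «S_pi_trunc carries no Bragg reading» (STATUS 22:40Z).  Zero compute; no
certificate typed; no `sorry`.  A CEILING on a Bragg weight says nothing about the presence of order.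

The engine menu's `S_pi_trunc2 = Σ_{|r|₁ ≤ 2} (−1)^{|r|₁} ω(𝐒₀·𝐒_r)` (13 displacements of the 1-norm diamond, `r = 0`
term `𝐒₀·𝐒₀ = ¾n₀ − (3/2)n_{0↑}n_{0↓}` included; eng-1 kit j246123 / j246548) has the staggered diamond DIRICHLET kernel
`D₂(ξ − (π,π))`, `D₂(η) = Σ_{|r|₁≤2} cos(r·η)`, which is NOT nonnegative: in `cᵢ = cos ηᵢ`,
`D₂ = 4c₁² + 4c₂² + 4c₁c₂ + 2c₁ + 2c₂ − 3`, minimum `−10/3` at `c₁ = c₂ = −1/6`.  But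

  `K(ξ) := 10/3 + D₂(ξ − (π,π)) = 13/3 − 2cos ξ₁ − 2cos ξ₂ + 2cos 2ξ₁ + 2cos 2ξ₂ + 2cos(ξ₁+ξ₂) + 2cos(ξ₁−ξ₂)`
  `       = 4(cos ξ₁ + ½cos ξ₂ − ¼)² + 3(cos ξ₂ − 1/6)² ≥ 0`,      `K((π,π)) = 49/3`

(`diamondKernel_eq`, `diamondKernel_nonneg`, `diamondKernel_pi_pi`), so `kernelCeiling_braggWeight_le` gives, for every
finite measure `μ` representing a lattice function `C` (`c = Re C`):

  `(49/3)·μ((π,π)+2πℤ²) ≤ (13/3)c(0) − 2[c(e₁)+c(e₂)] + 2[c(e₁+e₂)+c(e₁−e₂)] + 2[c(2e₁)+c(2e₂)]`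

(`neel_braggWeight_le_diamond`), i.e. for `D₄`-invariant `C`: `m ≤ (13·c(0,0) − 12·c(1,0) + 12·c(1,1) + 12·c(2,0))/49
= (10·c(0,0) + 3·S₂)/49` with `S₂ = c(0,0) − 4c(1,0) + 4c(1,1) + 4c(2,0)` the class form of `S_pi_trunc2`
(`braggWeight_pi_le_diamond2_classForm`).  State side: the WORD `spiTrunc2Word` (the menu functional verbatim: one-body
term `¾(n_{0↑}+n_{0↓})`, `−(3/2)n_{0↑}n_{0↓}`, the twelve signed spin dots on `diamond2Support`), its `D₄` dictionary, and
**`M3ObsNeelCeilingAt_of_spiTrunc2_orbitRow`: `M3CorrOrbitLowerRow t′ u r univ diamond2Support (−spiTrunc2Word) →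
M3EnergyUpperRow t′ u → M3ObsNeelCeilingAt t′ ((105/16 − 3·r)/49)`** (density `7/8`, `docc ≥ 0` kinematically via
`re_expect_doccAt0_nonneg`; `−r` = the certified upper edge of `S_pi_trunc2`).  Arithmetic on eng-1's in-job-certified
A0 value `S_pi_trunc2 ≤ 3.1270545` [certified by the producer's readers, NOT yet two-lineage/referee]: `m_s²(π,π) ≤
0.3253839 < 0.3399425` (#259) — recorded in words only; nothing here asserts it.

References: Scalapino, Phys. Rep. 250 (1995) 329, §2; Katznelson, *An Introduction to Harmonic Analysis* (2004) I.7.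
-/

noncomputable section

open MeasureTheory Complex Filter Topology
open scoped Real BigOperators

namespace Summit.Ventures.CertifiedManyBodySolver.Observables

/-! ## §1  The shifted diamond kernel -/

section Kernel

/-- DIAMOND taps (one per `±` pair): `0, e₁, e₂, e₁+e₂, e₁−e₂, 2e₁, 2e₂`. [cite: Scalapino1995, §2] -/
def diamond2TapVec : Fin 7 → (Fin 2 → ℤ) := ![![0, 0], ![1, 0], ![0, 1], ![1, 1], ![1, -1], ![2, 0], ![0, 2]]

/-- Tap weights of `K = 10/3 + D₂(· − (π,π))`: `13/3` at `0` (= `1 + 10/3`), `−2` on the axes, `+2` on the diagonals and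
at distance two (each `±` pair folded into one tap). [cite: Scalapino1995, §2] -/
def diamond2TapWt : Fin 7 → ℝ := ![13/3, -2, -2, 2, 2, 2, 2]

/-- Closed form: `K(ξ) = 4cos²ξ₁ + 4cos²ξ₂ + 4cos ξ₁ cos ξ₂ − 2cos ξ₁ − 2cos ξ₂ + 1/3`. [folklore] -/
theorem diamondKernel_eq (ξ : Fin 2 → ℝ) :
    cosKernel diamond2TapVec diamond2TapWt ξ =
      4 * Real.cos (ξ 0) ^ 2 + 4 * Real.cos (ξ 1) ^ 2 + 4 * Real.cos (ξ 0) * Real.cos (ξ 1)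
        - 2 * Real.cos (ξ 0) - 2 * Real.cos (ξ 1) + 1/3 := by
  unfold cosKernel
  simp only [Fin.sum_univ_seven, sum_fin_two_dot, diamond2TapVec, diamond2TapWt]
  simp [Real.cos_add, Real.cos_two_mul, Real.cos_sq']
  ring

/-- **`K ≥ 0` pointwise**: `K = 4(cos ξ₁ + ½cos ξ₂ − ¼)² + 3(cos ξ₂ − 1/6)²`. [folklore] -/
theorem diamondKernel_nonneg (ξ : Fin 2 → ℝ) : 0 ≤ cosKernel diamond2TapVec diamond2TapWt ξ := by
  rw [diamondKernel_eq]
  nlinarith [sq_nonneg (Real.cos (ξ 0) + Real.cos (ξ 1) / 2 - 1/4), sq_nonneg (Real.cos (ξ 1) - 1/6)]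

/-- `K((π,π)) = 49/3`. [folklore] -/
theorem diamondKernel_pi_pi : cosKernel diamond2TapVec diamond2TapWt ![π, π] = 49/3 := by
  rw [diamondKernel_eq]
  simp
  norm_num

end Kernel

/-! ## §2  Measure level -/

section MeasureLevel

open Literature.MathematicalPhysics.QuantumLattice Literature.Probability.LatticeModels

variable {C : Site 2 → ℂ} (μ : Measure (EuclideanSpace ℝ (Fin 2))) [IsFiniteMeasure μ]

/-- **Néel ceiling from the shifted diamond kernel** (any represented `C`):
`(49/3)·μ((π,π)+2πℤ²) ≤ (13/3)Re C(0) − 2[Re C(e₁)+Re C(e₂)] + 2[Re C(e₁+e₂)+Re C(e₁−e₂)] + 2[Re C(2e₁)+Re C(2e₂)]`.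
[cite: Katznelson2004, I.7] -/
theorem neel_braggWeight_le_diamond
    (hμ : ∀ r : Site 2, ∫ ξ, exp ((∑ i, (r i : ℝ) * ξ i : ℝ) * I) ∂μ = C r) :
    49/3 * braggWeight μ ![![π, π]] ≤
      13/3 * (C ![0, 0]).re - 2 * (C ![1, 0]).re - 2 * (C ![0, 1]).re + 2 * (C ![1, 1]).re
        + 2 * (C ![1, -1]).re + 2 * (C ![2, 0]).re + 2 * (C ![0, 2]).re := by
  have h := kernelCeiling_braggWeight_le μ hμ diamond2TapVec diamond2TapWt diamondKernel_nonneg ![![π, π]] (49/3)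
    (fun j => by fin_cases j; simpa using diamondKernel_pi_pi)
  have hsum : ∑ l, diamond2TapWt l * (C (diamond2TapVec l)).re =
      13/3 * (C ![0, 0]).re - 2 * (C ![1, 0]).re - 2 * (C ![0, 1]).re + 2 * (C ![1, 1]).re
        + 2 * (C ![1, -1]).re + 2 * (C ![2, 0]).re + 2 * (C ![0, 2]).re := by
    simp only [Fin.sum_univ_seven, diamond2TapVec, diamond2TapWt]
    simp
    ring
  linarith

/-- **Class form for `D₄`-invariant `C`**: `μ((π,π)+2πℤ²) ≤ (13·c(0,0) − 12·c(1,0) + 12·c(1,1) + 12·c(2,0))/49`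
`= (10·c(0,0) + 3·S₂)/49`, `S₂ = c(0,0) − 4c(1,0) + 4c(1,1) + 4c(2,0)` = the class form of `S_pi_trunc2`.
[cite: Scalapino1995, §2] -/
theorem braggWeight_pi_le_diamond2_classForm
    (hμ : ∀ r : Site 2, ∫ ξ, exp ((∑ i, (r i : ℝ) * ξ i : ℝ) * I) ∂μ = C r)
    (hC : ∀ (γ : DihedralGroup 4) (v : Site 2), C (d4Vec γ v) = C v) :
    braggWeight μ ![![π, π]] ≤
      (13 * (C ![0, 0]).re - 12 * (C ![1, 0]).re + 12 * (C ![1, 1]).re + 12 * (C ![2, 0]).re) / 49 := by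
  have h := neel_braggWeight_le_diamond μ hμ
  obtain ⟨-, e2, -, -, -, e6, -, e8, -⟩ := d4Invariant_box3_values hC
  rw [e2, e6, e8] at h
  rw [le_div_iff₀ (by norm_num : (0 : ℝ) < 49)]
  linarith

end MeasureLevel

/-! ## §3  States: the word `spiTrunc2Word`, its dictionary, and the leaf -/

section States

open Matrix Literature.MathematicalPhysics.QuantumLattice Literature.Probability.LatticeModels
open Literature.MathematicalPhysics.QuantumLattice.ThermodynamicLimit
open HubbardWave0 Literature.MathematicalPhysics.QuantumManyBody.StateRelaxation
open Summit.HubbardSuperconductivity.ManyBodyBootstrap.Bounds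
open Literature.MathematicalPhysics.QuantumLattice.FermionSpinMoment
open Summit.Ventures.CertifiedManyBodySolver.Certificates
open Summit.Ventures.CertifiedManyBodySolver.Transport
open Summit.Ventures.CertifiedManyBodySolver.SpinStarTL
open DihedralGroup

/-- State form: for every state `ω` and every finite measure representing `spinOrbitCorr ω`,
`μ((π,π)+2πℤ²) ≤ (13·c(0,0) − 12·c(1,0) + 12·c(1,1) + 12·c(2,0))/49`, `c = Re spinOrbitCorr ω`.  A CEILING.
[cite: Scalapino1995, §2] -/
theorem neel_braggWeight_le_diamond2 (ω : InfVolFermionState 2)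
    (μ : Measure (EuclideanSpace ℝ (Fin 2))) [IsFiniteMeasure μ]
    (hμ : ∀ r : Site 2, ∫ ξ, exp ((∑ i, (r i : ℝ) * ξ i : ℝ) * I) ∂μ = spinOrbitCorr ω r) :
    braggWeight μ ![![π, π]] ≤
      (13 * (spinOrbitCorr ω ![0, 0]).re - 12 * (spinOrbitCorr ω ![1, 0]).re + 12 * (spinOrbitCorr ω ![1, 1]).re
        + 12 * (spinOrbitCorr ω ![2, 0]).re) / 49 :=
  braggWeight_pi_le_diamond2_classForm μ hμ (spinOrbitCorr_d4Vec ω)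

/-- The diamond support `{r : |r|₁ ≤ 2} ⊆ ℤ²` (13 sites). [cite: Scalapino1995, §2] -/
abbrev diamond2Support : Finset (Site 2) :=
  {0, ![1, 0], ![-1, 0], ![0, 1], ![0, -1], ![1, 1], ![-1, -1], ![1, -1], ![-1, 1], ![2, 0], ![-2, 0], ![0, 2], ![0, -2]}

/-- On-site part of the `S_pi_trunc2` word: `𝐒₀·𝐒₀ = ¾(n_{0↑}+n_{0↓}) − (3/2)n_{0↑}n_{0↓}`. [cite: Scalapino1995, §2] -/
def spiTrunc2OnSite : FermionOp diamond2Support :=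
  ((3/4 : ℚ) : ℂ) • (nAt 0 (by decide) 0 + nAt 0 (by decide) 1) +
  ((-3/2 : ℚ) : ℂ) • (nAt 0 (by decide) 0 * nAt 0 (by decide) 1)

/-- Nearest-neighbour part: `Σ_{v ∈ {±e₁, ±e₂}} 𝐒₀·𝐒_v` (enters with sign `−`). [cite: Scalapino1995, §2] -/
def spiTrunc2NN : FermionOp diamond2Support :=
  spinDotAt 0 (by decide) ![1, 0] (by decide) + spinDotAt 0 (by decide) ![-1, 0] (by decide) +
  spinDotAt 0 (by decide) ![0, 1] (by decide) + spinDotAt 0 (by decide) ![0, -1] (by decide)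

/-- Diagonal part: `Σ_{v ∈ {±(e₁+e₂), ±(e₁−e₂)}} 𝐒₀·𝐒_v`. [cite: Scalapino1995, §2] -/
def spiTrunc2Diag : FermionOp diamond2Support :=
  spinDotAt 0 (by decide) ![1, 1] (by decide) + spinDotAt 0 (by decide) ![-1, -1] (by decide) +
  spinDotAt 0 (by decide) ![1, -1] (by decide) + spinDotAt 0 (by decide) ![-1, 1] (by decide)

/-- Distance-two axial part: `Σ_{v ∈ {±2e₁, ±2e₂}} 𝐒₀·𝐒_v`. [cite: Scalapino1995, §2] -/
def spiTrunc2Ax2 : FermionOp diamond2Support :=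
  spinDotAt 0 (by decide) ![2, 0] (by decide) + spinDotAt 0 (by decide) ![-2, 0] (by decide) +
  spinDotAt 0 (by decide) ![0, 2] (by decide) + spinDotAt 0 (by decide) ![0, -2] (by decide)

/-- **The op-08 `S_pi_trunc2` WORD** (menu `oplayer.observables/0.1.0`, verbatim): `Σ_{|r|₁ ≤ 2} (−1)^{|r|₁} 𝐒₀·𝐒_r`
= on-site − nearest-neighbour + diagonal + distance-two parts. [cite: Scalapino1995, §2] -/
def spiTrunc2Word : FermionOp diamond2Support :=
  spiTrunc2OnSite - spiTrunc2NN + spiTrunc2Diag + spiTrunc2Ax2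

variable {ω : InfVolFermionState 2}

/-- `Re ω_Λ(n_{x↑}) + Re ω_Λ(n_{x↓}) = ρ(ω)` on any region (translation invariance + compatibility). [folklore] -/
theorem re_expect_nAt_add_re_expect_nAt_eq_density (hω : ω.IsTranslationInvariant) {Λ : Finset (Site 2)} (x : Site 2)
    (hx : x ∈ Λ) : (ω.expect Λ (nAt x hx 0)).re + (ω.expect Λ (nAt x hx 1)).re = ω.density := by
  have hsub : ({x} : Finset (Site 2)) ⊆ Λ := Finset.singleton_subset_iff.2 hx
  have h0 := ω.compatible hsub (nAt x (Finset.mem_singleton_self x) 0)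
  have h1 := ω.compatible hsub (nAt x (Finset.mem_singleton_self x) 1)
  simp only [nAt, fermionEmbed_numberOp, PolySite.incl_pt] at h0 h1
  have h := re_expect_nAt_add_nAt_eq_density hω x
  simp only [nAt, map_add, Complex.add_re] at h ⊢
  rw [h0, h1]
  exact h

/-- Dictionary, on-site part: `Re ω(Γ(γ)·onsite) = ¾ρ − (3/2)docc`. [folklore] -/
theorem re_expect_d4_spiTrunc2OnSite (hω : ω.IsTranslationInvariant) (g : DihedralGroup 4) :
    (ω.expect (d4ShiftSet g 0 diamond2Support)
        (fermionEmbed (PolySite.d4Emb g 0 diamond2Support) spiTrunc2OnSite)).re =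
      3/4 * ω.density - 3/2 * docc ω := by
  have h0 : (0 : Site 2) ∈ diamond2Support := by decide
  have hd := re_expect_nAt_add_re_expect_nAt_eq_density hω (Λ := d4ShiftSet g 0 diamond2Support) (d4Vec g 0 + 0)
    (d4Vec_add_mem_d4ShiftSet g 0 h0)
  have hdocc := re_expect_nAt_mul_nAt_eq_docc hω (Λ := d4ShiftSet g 0 diamond2Support) (d4Vec g 0 + 0)
    (d4Vec_add_mem_d4ShiftSet g 0 h0)
  unfold spiTrunc2OnSite
  simp only [map_add, map_smul, map_mul, fermionEmbed_numberOp, d4Emb_pt, smul_eq_mul, Complex.add_re]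
  push_cast
  rw [show (3/4 : ℂ) = ((3/4 : ℝ) : ℂ) by norm_num, show (-3/2 : ℂ) = ((-3/2 : ℝ) : ℂ) by norm_num]
  simp only [Complex.re_ofReal_mul, Complex.add_re]
  simp only [nAt] at hd hdocc
  rw [hdocc]
  linarith [hd]

/-- Dictionary, nearest-neighbour part. [folklore] -/
theorem re_expect_d4_spiTrunc2NN (hω : ω.IsTranslationInvariant) (g : DihedralGroup 4) :
    (ω.expect (d4ShiftSet g 0 diamond2Support)
        (fermionEmbed (PolySite.d4Emb g 0 diamond2Support) spiTrunc2NN)).re =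
      Certificates.spinCorr ω (d4Vec g ![1, 0]) + Certificates.spinCorr ω (d4Vec g ![-1, 0]) +
        Certificates.spinCorr ω (d4Vec g ![0, 1]) + Certificates.spinCorr ω (d4Vec g ![0, -1]) := by
  unfold spiTrunc2NN
  simp only [spinDotAt, map_add, fermionEmbed_fermionSpinDot, d4Emb_pt, Complex.add_re,
    re_expect_fermionSpinDot_eq_spinCorr hω, PolySite.ofLex_coe_pt, d4Vec_zero, add_zero, sub_zero]

/-- Dictionary, diagonal part. [folklore] -/
theorem re_expect_d4_spiTrunc2Diag (hω : ω.IsTranslationInvariant) (g : DihedralGroup 4) :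
    (ω.expect (d4ShiftSet g 0 diamond2Support)
        (fermionEmbed (PolySite.d4Emb g 0 diamond2Support) spiTrunc2Diag)).re =
      Certificates.spinCorr ω (d4Vec g ![1, 1]) + Certificates.spinCorr ω (d4Vec g ![-1, -1]) +
        Certificates.spinCorr ω (d4Vec g ![1, -1]) + Certificates.spinCorr ω (d4Vec g ![-1, 1]) := by
  unfold spiTrunc2Diag
  simp only [spinDotAt, map_add, fermionEmbed_fermionSpinDot, d4Emb_pt, Complex.add_re,
    re_expect_fermionSpinDot_eq_spinCorr hω, PolySite.ofLex_coe_pt, d4Vec_zero, add_zero, sub_zero]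

/-- Dictionary, distance-two part. [folklore] -/
theorem re_expect_d4_spiTrunc2Ax2 (hω : ω.IsTranslationInvariant) (g : DihedralGroup 4) :
    (ω.expect (d4ShiftSet g 0 diamond2Support)
        (fermionEmbed (PolySite.d4Emb g 0 diamond2Support) spiTrunc2Ax2)).re =
      Certificates.spinCorr ω (d4Vec g ![2, 0]) + Certificates.spinCorr ω (d4Vec g ![-2, 0]) +
        Certificates.spinCorr ω (d4Vec g ![0, 2]) + Certificates.spinCorr ω (d4Vec g ![0, -2]) := by
  unfold spiTrunc2Ax2
  simp only [spinDotAt, map_add, fermionEmbed_fermionSpinDot, d4Emb_pt, Complex.add_re,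
    re_expect_fermionSpinDot_eq_spinCorr hω, PolySite.ofLex_coe_pt, d4Vec_zero, add_zero, sub_zero]

/-- Dictionary: `Re ω(Γ(γ)·spiTrunc2Word) = ¾ρ − (3/2)docc − Σ_{nn} C_ω(γv) + Σ_{diag} C_ω(γv) + Σ_{dist 2} C_ω(γv)`.
[folklore] -/
theorem re_expect_d4_spiTrunc2Word (hω : ω.IsTranslationInvariant) (g : DihedralGroup 4) :
    (ω.expect (d4ShiftSet g 0 diamond2Support)
        (fermionEmbed (PolySite.d4Emb g 0 diamond2Support) spiTrunc2Word)).re =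
      3/4 * ω.density - 3/2 * docc ω
        - (Certificates.spinCorr ω (d4Vec g ![1, 0]) + Certificates.spinCorr ω (d4Vec g ![-1, 0]) +
            Certificates.spinCorr ω (d4Vec g ![0, 1]) + Certificates.spinCorr ω (d4Vec g ![0, -1]))
        + (Certificates.spinCorr ω (d4Vec g ![1, 1]) + Certificates.spinCorr ω (d4Vec g ![-1, -1]) +
            Certificates.spinCorr ω (d4Vec g ![1, -1]) + Certificates.spinCorr ω (d4Vec g ![-1, 1]))
        + (Certificates.spinCorr ω (d4Vec g ![2, 0]) + Certificates.spinCorr ω (d4Vec g ![-2, 0]) +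
            Certificates.spinCorr ω (d4Vec g ![0, 2]) + Certificates.spinCorr ω (d4Vec g ![0, -2])) := by
  simp only [spiTrunc2Word, map_add, map_sub, Complex.add_re, Complex.sub_re, re_expect_d4_spiTrunc2OnSite hω,
    re_expect_d4_spiTrunc2NN hω, re_expect_d4_spiTrunc2Diag hω, re_expect_d4_spiTrunc2Ax2 hω]

/-- **Dictionary, orbit mean**: for translation-invariant `ω` of density `7/8`, an orbit-mean UPPER bound
`(1/8)Σ_γ Re ω(Γ(γ)·spiTrunc2Word) ≤ U` reads `21/32 − (3/2)docc − 4c(1,0) + 4c(1,1) + 4c(2,0) ≤ U` in the class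
values `c = Re spinOrbitCorr ω`. [folklore] -/
theorem spiTrunc2_classForm_le_of_orbitRow (hω : ω.IsTranslationInvariant) (hn : ω.density = 7/8) {U : ℝ}
    (h : ((Finset.univ : Finset (DihedralGroup 4)).card : ℝ)⁻¹ *
        ∑ g ∈ (Finset.univ : Finset (DihedralGroup 4)), (ω.expect (d4ShiftSet g 0 diamond2Support)
          (fermionEmbed (PolySite.d4Emb g 0 diamond2Support) spiTrunc2Word)).re ≤ U) :
    21/32 - 3/2 * docc ω - 4 * (spinOrbitCorr ω ![1, 0]).re + 4 * (spinOrbitCorr ω ![1, 1]).re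
      + 4 * (spinOrbitCorr ω ![2, 0]).re ≤ U := by
  obtain ⟨e1, e2, e3, e4, e5, e6, e7, e8, e9, -⟩ := d4Invariant_box3_values (spinOrbitCorr_d4Vec ω)
  simp only [re_expect_d4_spiTrunc2Word hω, hn, Finset.sum_add_distrib, Finset.sum_sub_distrib, Finset.sum_const,
    Finset.card_univ, DihedralGroup.card, nsmul_eq_mul] at h
  have c1 := spinOrbitCorr_re ω ![1, 0]
  have c2 := spinOrbitCorr_re ω ![-1, 0]
  have c3 := spinOrbitCorr_re ω ![0, 1]
  have c4 := spinOrbitCorr_re ω ![0, -1]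
  have c5 := spinOrbitCorr_re ω ![1, 1]
  have c6 := spinOrbitCorr_re ω ![-1, -1]
  have c7 := spinOrbitCorr_re ω ![1, -1]
  have c8 := spinOrbitCorr_re ω ![-1, 1]
  have c9 := spinOrbitCorr_re ω ![2, 0]
  have c10 := spinOrbitCorr_re ω ![-2, 0]
  have c11 := spinOrbitCorr_re ω ![0, 2]
  have c12 := spinOrbitCorr_re ω ![0, -2]
  rw [e1] at c2; rw [e2] at c3; rw [e3] at c4; rw [e4] at c6; rw [e6] at c7; rw [e5] at c8
  rw [e7] at c10; rw [e8] at c11; rw [e9] at c12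
  push_cast at h
  linarith

/-- **Orbit row on the diamond word ⇒ Néel ceiling.**  A `D₄`-reduced certificate on `S_pi_trunc2`, typed as
`M3CorrOrbitLowerRow t′ u r univ diamond2Support (−spiTrunc2Word)` (so `S_pi_trunc2 ≤ −r` in orbit mean, GIVEN
`e₀ ≤ u`), plus the window node `M3EnergyUpperRow t′ u`, gives `M3ObsNeelCeilingAt t′ ((105/16 − 3·r)/49)`:
`m ≤ (10·c(0,0) + 3·S₂)/49`, `c(0,0) = ¾(7/8 − 2·docc) ≤ 21/32` (`docc ≥ 0`, `re_expect_doccAt0_nonneg`).  With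
eng-1's A0 value `−r = 3.1270545` this reads `m_s²(π,π) ≤ 0.3253839` [arithmetic; the row's own status applies].
[cite: Scalapino1995, §2] -/
theorem M3ObsNeelCeilingAt_of_spiTrunc2_orbitRow {tp : ℝ} {u r : ℚ}
    (hrow : M3CorrOrbitLowerRow tp u r Finset.univ diamond2Support (-spiTrunc2Word))
    (hE : M3EnergyUpperRow tp u) :
    M3ObsNeelCeilingAt tp ((105/16 - 3 * r) / 49) := by
  intro ω Ls ψ hLs hψ hψ1 hlim μ hfin hμ
  obtain ⟨hω, hn⟩ := m3_rowState_invariances hLs hψ hψ1 hlim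
  have h := hrow ω Ls ψ hLs hψ hψ1 hlim hE
  simp only [map_neg, Complex.neg_re, Finset.sum_neg_distrib, mul_neg] at h
  have h' := spiTrunc2_classForm_le_of_orbitRow hω hn (le_neg.1 h)
  have hb := neel_braggWeight_le_diamond2 ω μ hμ
  have h0 := spinOrbitCorr_re_zero hω hn
  have hd : 0 ≤ docc ω := re_expect_doccAt0_nonneg ω
  rw [h0] at hb
  refine hb.trans ?_
  rw [div_le_div_iff_of_pos_right (by norm_num : (0:ℝ) < 49)]
  linarith

end States

end Summit.Ventures.CertifiedManyBodySolver.Observables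

end
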